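import Literature.MathematicalPhysics.QuantumFieldTheory.YangMillsOS
import Literature.MathematicalPhysics.QuantumFieldTheory.LatticeGaugeDobrushinPoincare
import HarnessLib

/-!
# Laplace concentration of strongly pinned one-link laws (named fact)

For a compact simple `G` with a faithful continuous unitary matrix representation `ρ = r.ρ`
(`LatticeRep`), the one-link conditional laws of strongly *pinned* Wilson lattice gauge measures
are tilted Haar measures `ν(dg) ∝ exp(s Re tr ρ(h⁻¹ g) + β W(g)) dg` whose perturbation `W` is a
bounded combination of words of length four in `ρ(g)^{±1}` and constant unitaries (staples), at
most `32` of which contain the variable link. In the Laplace regime `s ≥ c₀ (1 + β)` these laws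
concentrate at scale `s^{-1/2}` around the unique non-degenerate maximiser of the exponent, so
that Lipschitz observables (for the chordal distance `‖ρ a − ρ b‖_F`) have variance `O(Lip²/s)`,
uniformly in `h`, in the words and in `β`.

This file records that statement as a NAMED FACT (`OneLinkLaplaceConcentration`, unproved here).
It is the multivariate Laplace method at an interior non-degenerate maximum (Breitung, LNM 1592,
Ch. 5, Thm. 41; with a lower-order perturbation term, Thm. 44) applied on the compact Lie group
`ρ(G) ⊆ U(N)` in exponential coordinates (closed linear groups are Lie groups with Haar measure a
smooth positive density in the chart: Bröcker–tom Dieck I (3.11), I.5; Sepanski Thm. 3.28) and made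
uniform over the `C²`-compact family of exponents. The tree cannot yet express the exponential
chart of an abstract compact group with a faithful representation, which is why the statement is
vendored in the form its consumer needs
(`Summit.QuantumFields.YangMills.Theorems.StrongPinningPoincare.strongPinningPoincare_of_oneLinkLaplace`,
route `FradkinShenkerFlow` of `YangMills`, item `StrongPinningPoincare`).

## References

* K. W. Breitung, *Asymptotic Approximations for Probability Integrals*, LNM 1592 (1994), Ch. 5,
  Thm. 41 (p. 56) and Thm. 44 (p. 62).
* T. Bröcker, T. tom Dieck, *Representations of Compact Lie Groups* (1985), I (3.11), I §5,
  III (4.1).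
* M. R. Sepanski, *Compact Lie Groups* (2007), Thm. 3.28.
-/

noncomputable section

open MeasureTheory

namespace Literature.MathematicalPhysics.QuantumFieldTheory

/-- **Laplace concentration of strongly pinned one-link laws** (compact simple `G` with a
faithful unitary lattice representation `r`, `ρ = r.ρ : G → U(N)`). There are `c₀, K₁ > 0`
(depending on `G, r` only) such that for every `β ≥ 0`, every `s ≥ c₀ (1 + β)`, every pinning
centre `h ∈ G` and every perturbation by words of length four —
`W(g) = ∑ₘ wₘ Re tr(ρ(vₘ₀(g)) ρ(vₘ₁(g)) ρ(vₘ₂(g))ᴴ ρ(vₘ₃(g))ᴴ)`, `|wₘ| ≤ 1`, each letter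
`vₘₖ(g)` being either the variable `g` (`none`) or a constant group element (`some u`), with at
most `32` words containing the variable — the probability measure
`ν(dg) ∝ exp(s Re tr ρ(h⁻¹ g) + β W(g)) dHaar(g)` on `G` satisfies `Var_ν(ψ) ≤ K₁ M² / s` for every
bounded measurable `ψ` with `|ψ a − ψ b| ≤ M ‖ρ a − ρ b‖_F`. (Multivariate Laplace method at an
interior non-degenerate maximum, Breitung LNM 1592 Ch. 5 Thm. 41/44, on the compact Lie group
`ρ(G) ⊆ U(N)` in exponential coordinates, uniformly over the `C²`-compact family of exponents
`{Re tr ρ(h⁻¹·) + (β/s) W}`, `β/s ≤ 1/c₀`.)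
-- TODO(general form): the printed theorems give the fixed-phase asymptotics
-- `∫ e^{λ f} h ~ c λ^{-n/2}` (and the Lie structure of `ρ(G)`); the uniform second-moment bound
-- over the word family stated here is their standard corollary and is what the lattice
-- application consumes.
[cite: Breitung1994, Ch. 5 Thm. 41 and Thm. 44] -/
def OneLinkLaplaceConcentration : Prop :=
  ∀ (G : Type) [Group G] [TopologicalSpace G] [IsTopologicalGroup G] [CompactSpace G]
    [MeasurableSpace G] [BorelSpace G], IsCompactSimpleLieGroup G →
    ∀ (r : LatticeRep G), ∃ c₀ K₁ : ℝ, 0 < c₀ ∧ 0 < K₁ ∧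
      ∀ (β : ℝ), 0 ≤ β → ∀ (s : ℝ), c₀ * (1 + β) ≤ s →
        ∀ (h : G) (Λ : Type) [Fintype Λ] (w : Λ → ℝ) (v : Λ → Fin 4 → Option G),
        (∀ m, |w m| ≤ 1) → (∀ T : Finset Λ, (∀ m ∈ T, ∃ k, v m k = none) → T.card ≤ 32) →
        ∀ (ψ : G → ℝ) (M : ℝ), Measurable ψ → (∃ C, ∀ g, |ψ g| ≤ C) → 0 ≤ M →
        (∀ a b, |ψ a - ψ b| ≤ M * frobNorm (r.ρ a - r.ρ b)) →
        ∫ g, (ψ g - ∫ g', ψ g' ∂((haarProbability G).tilted (fun g => s * (r.ρ (h⁻¹ * g)).trace.re +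
            β * ∑ m, w m * (r.ρ ((v m 0).getD g) * r.ρ ((v m 1).getD g) *
              Matrix.conjTranspose (r.ρ ((v m 2).getD g)) *
              Matrix.conjTranspose (r.ρ ((v m 3).getD g))).trace.re))) ^ 2
          ∂((haarProbability G).tilted (fun g => s * (r.ρ (h⁻¹ * g)).trace.re +
            β * ∑ m, w m * (r.ρ ((v m 0).getD g) * r.ρ ((v m 1).getD g) *
              Matrix.conjTranspose (r.ρ ((v m 2).getD g)) *
              Matrix.conjTranspose (r.ρ ((v m 3).getD g))).trace.re))
          ≤ M ^ 2 / (s / K₁)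

end Literature.MathematicalPhysics.QuantumFieldTheory

end
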